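import Summits.QuantumFields.YangMills.Theorems.BalabanLadderIRColdDoublingRecursionSC
import Summits.QuantumFields.YangMills.Theorems.BalabanLadderIRColdPressureOnsetFalseOfLightFlux
import Summits.QuantumFields.YangMills.Theorems.NonSimplyConnectedLatticeGap.Negative.FalseWithoutNonAbelianOfU1Massless
import Literature.MathematicalPhysics.QuantumFieldTheory.YangMillsOSNonempty
import HarnessLib

/-!
# Line `lightmode-exposure` (ideator ym-ir-idea-10, lens «negation») on crux `IR` (stmt-QuantumFields-19354):
# the group-blind obstruction to the seed `E = ColdExitSC` AS A THEOREM

HONEST FRAMING.  Nothing here proves the Yang–Mills mass gap (Clay), the crux `BalabanLadder.IR`, or `E`; R4 closes only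
the conditional finite-𝕋⁴ rung `BalabanLadder.UV`.  This module is NEGATIVE KNOWLEDGE about the seed `E` of the desk's
lines of record 10 (`doubling-bridge`: `IR_of_bridge coldDoublingRecursionSC_holds hE hX hN`) and 13 (`floor-handshake`),
kernel-checked, plus ONE open stub (`stub_u1TorusMassless`, the Guth–Fröhlich–Spencer photon in torus form) that would make
the `U(1)` exposure unconditional.

STRATEGY (why this line).  `R = ColdDoublingRecursionSC` is a tree theorem for EVERY compact `G` (`AspectBootstrap.tracePositive`,
`axisSymmetric`, `volumeBounds`, `defectSquaring`; the simplicity binders are unused), and the seam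
`ColdPurityBridge.coldPressureAt_of_exit_recursion` is group-blind.  Hence the per-`(G, r)` body of `E`,
`ColdExitAt r := ∀ ε > 0, ∃ β₁, ∀ β ≥ β₁, ∀ L₀, ∃ L ≥ L₀, coldDefect r.ρ β L ≤ ε`, implies for EVERY compact `G`
a per-β cold-pressure onset (`coldPressureOnsetAt_of_coldExitAt`), which (i) the landed
`ColdPressurePincer.coldPressureOnsetAt_false_of_lightFluxMode` kills under `LightFluxMode G` and (ii) the landed
`TraceNormColdPressure.abs_latticeConnectedCorr_le_of_coldPressure` turns into per-β volume-uniform exponential clustering of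
every pair of local species (`torusClustering_of_coldExitAt`).  Consequences, all sorry-free:

* `coldExitAt_false_of_lightFluxMode` — `LightFluxMode G → ∀ r, ¬ ColdExitAt r` for EVERY compact `G` (no simplicity, no π₁);
* `coldExitSC_imp_noLightFluxModeSC` — the TYPED NECESSARY CONDITION of `E`: `E → NoLightFluxModeSC` (no light RP-slab mode for
  any compact simple simply-connected `G` at any large `β`) — the weakest consequence of `E` in covariance currency, killable;
* `not_coldExitSimple_of_lightFluxMode_SO3` — `E` with the binder `SimplyConnectedSpace G` deleted is FALSE modulo
  `LightFluxMode SO(3)` ('t Hooft's light ℤ₂ magnetic flux; `π₁ = ℤ₂`): the π₁-binder is load-bearing;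
* `not_coldExitAllGroups_of_lightFluxMode_circle`, `not_coldExitAllGroups_of_u1TorusMassless` — `E` with BOTH group binders deleted
  (every compact metrisable `G`) is FALSE at `G = U(1)` modulo the massless photon, in either currency: the RP-slab form
  `LightFluxMode Circle` or the species form `U1TorusMassless` (= VERBATIM the hypothesis `hU` of the landed
  `NonSimplyConnectedLatticeGap.Negative.nonSimplyConnectedLatticeGap_false_without_nonAbelian_of_u1Massless`, so ONE proof of the
  Guth–FS photon on tori discharges both negatives); `U(1)` passes every clause of the binders except non-abelianness and `π₁ = 1`
  (`circle_passes_all_but_nonAbelian`).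

READING (census §K B-GROUP-BLIND made kernel for the seed `E`): any `X ⇒ E`-type input valid for every compact `G` is false; the
exact detector Prop is `LightFluxMode` (RP-slab covariance `≥ e^{−εS}` at every large β), which `U(1)` (photon, `π₁ = ℤ`) and
`SO(3)` (magnetic flux, `π₁ = ℤ₂`) both carry for DIFFERENT light modes; for compact connected Lie `G` both are `π₁(G) ≠ 1`
phenomena, so the load-bearing binder of `E` is `SimplyConnectedSpace G`.  NOT hit: `H = FloorToPuritySC` and `IR` itself, whose
hypotheses (`ε ≤ Q2` floors ∕ `LowerBounds`) FAIL at `U(1)` for every unit map (`Q2(U(1)) = O(β⁻²)`; ideator −9 `irAt_circle`), so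
they hold VACUOUSLY at `U(1)` — the `U(1)` sieve does not apply to floor-conditioned statements (use `U(1) × SU(2)`, card −9).

Refs: Guth, Phys. Rev. D21 (1980) 2291; Fröhlich–Spencer, Commun. Math. Phys. 83 (1982) 411 (§2.11, p. 433); 't Hooft, Nucl. Phys.
B153 (1979) 141; Osterwalder–Seiler, Ann. Phys. 110 (1978) §3; tree `Literature.Barriers.QuantumFields.AbelianDeconfinementD4`.
-/

set_option autoImplicit false

noncomputable section

open Filter Topology MeasureTheory
open scoped SchwartzMap
open Literature.MathematicalPhysics.QuantumFieldTheory Literature.MathematicalPhysics.QuantumLattice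
open Literature.MathematicalPhysics.QuantumFieldTheory.Balaban1983to89.Sufficient (ColdPressureBound)
open Summit.QuantumFields.YangMills.Cruxes.IR.ColdPurityBridge
  (coldDefect ColdExitSC ColdDoublingRecursionSC coldPressureAt_of_exit_recursion IR_of_bridge)
open Summit.QuantumFields.YangMills.Cruxes.IR.ColdPressurePincer
  (ColdPressureAt AFToColdPressure IRnsc ColdPressureOnsetSC coldPressureOnsetAt_false_of_lightFluxMode)
open Summit.QuantumFields.YangMills.Cruxes.IR.AspectBootstrap
  (coldDefect_eq_boxDefect axisSymmetric tracePositive volumeBounds defectSquaring squaringConst squaringConst_pos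
    coldDoublingRecursionSC_holds)
open Summit.QuantumFields.YangMills.Theorems.GapAtCorrelationLength.Negative (LightFluxMode)
open Summit.QuantumFields.YangMills.Theorems.WeakCouplingHypercubicLimit.TraceNormColdPressure
  (abs_latticeConnectedCorr_le_of_coldPressure)
open Summit.QuantumFields.YangMills.Cruxes.IR.FluxCodeBlindness (volumeFloor_eventually)
open Literature.AlgebraicTopology.FundamentalGroup (SO3)
open Summit.QuantumFields.YangMills.Theorems.NonSimplyConnectedLatticeGap
  (so3_isTopologicalGroup so3_compactSpace isCompactSimpleLieGroup_SO3 nonempty_latticeRep_SO3)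
open Summit.QuantumFields.YangMills.Theorems.NonSimplyConnectedLatticeGap.Negative
  (not_simplyConnectedSpace_circle circle_passes_all_but_nonAbelian)

namespace Summit.QuantumFields.YangMills.Cruxes.IR.LightModeExposure

/-! ## §0 The per-`(G, r)` body of `E` and the binder-deleted forms -/

section Defs

variable {G : Type} [Group G] [TopologicalSpace G] [IsTopologicalGroup G] [CompactSpace G]
  [MeasurableSpace G] [BorelSpace G]

/-- **`E` at one structure group and one lattice representation** — VERBATIM the body of `ColdPurityBridge.ColdExitSC`:
for every `ε > 0`, beyond some `β₁(ε)`, the 4:1 cold box `L³ × L/4` is `ε`-pure at SOME arbitrarily large `L`. -/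
def ColdExitAt (r : LatticeRep G) : Prop :=
  ∀ ε : ℝ, 0 < ε → ∃ β₁ : ℝ, ∀ β : ℝ, β₁ ≤ β → ∀ L₀ : ℕ, ∃ L : ℕ, L₀ ≤ L ∧ coldDefect r.ρ β L ≤ ε

/-- Per-`(G, r, β)` volume-uniform exponential clustering of every pair of local species on the tori `(2S+1)⁴`, `n ≤ S`
(VERBATIM the clustering body negated in `U1TorusMassless` below and in the landed `NonSimplyConnectedLatticeGap` negative). -/
def TorusClusteringAt {N : ℕ} (ρ : G →* Matrix (Fin N) (Fin N) ℂ) (β : ℝ) : Prop :=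
  ∃ m : ℝ, 0 < m ∧ ∃ S₁ : ℕ, ∀ A B : YMSpecies G, ∃ C : ℝ, ∀ S n : ℕ, S₁ ≤ S → n ≤ S →
    |latticeConnectedCorr ρ β (2 * S + 1) A.F B.F n| ≤ C * Real.exp (-(m * n))

end Defs

/-- **`E` with BOTH group binders deleted**: cold exit for every compact metrisable group and every lattice representation
(the form a GROUP-BLIND proof of `E` would establish). -/
def ColdExitAllGroups : Prop :=
  ∀ (G : Type) [Group G] [TopologicalSpace G] [IsTopologicalGroup G] [CompactSpace G],
    letI : MeasurableSpace G := borel G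
    haveI : BorelSpace G := ⟨rfl⟩
    ∀ r : LatticeRep G, ColdExitAt r

/-- **`E` with only the binder `SimplyConnectedSpace G` deleted** (all compact simple `G`, `SO(3)`, `PSU(N)` included). -/
def ColdExitSimple : Prop :=
  ∀ (G : Type) [Group G] [TopologicalSpace G] [IsTopologicalGroup G] [CompactSpace G],
    IsCompactSimpleLieGroup G →
    letI : MeasurableSpace G := borel G
    haveI : BorelSpace G := ⟨rfl⟩
    ∀ r : LatticeRep G, ColdExitAt r

/-- **The typed necessary condition of `E` (negation lens: the obstruction as a Prop).**  No compact simple simply-connected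
`G` has a light RP-slab mode: for some lattice representation, at an unbounded set of couplings, every unit-bounded slab
functional clusters at SOME exponential rate on all large tori.  FALSE off the class: `SO(3)` ('t Hooft flux), `U(1)`
(photon) — physics-certain, rigorously open both ways. -/
def NoLightFluxModeSC : Prop :=
  ∀ (G : Type) [Group G] [TopologicalSpace G] [IsTopologicalGroup G] [CompactSpace G],
    IsCompactSimpleLieGroup G → SimplyConnectedSpace G → ¬ LightFluxMode G

/-- **Weak-coupling torus masslessness of Wilson `U(1)₄`** — VERBATIM the hypothesis `hU` of the landed
`nonSimplyConnectedLatticeGap_false_without_nonAbelian_of_u1Massless` (`= Cruxes/NonSimplyConnectedLatticeGap/Disproof.U1WilsonTorusMasslessD4`):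
for every `β₀` some `β ≥ β₀` at which NO rate `m > 0` clusters all pairs of local species volume-uniformly — the torus form of
the Guth–Fröhlich–Spencer Coulomb phase (printed for the Villain action, FS82 §2.11; Wilson's asserted ibid. p. 433; open as
typed, like `Literature.Barriers.QuantumFields.AbelianMasslessPhaseD4`). [cite: FrohlichSpencerCMP1982, §2.11] -/
def U1TorusMassless : Prop :=
  ∀ β₀ : ℝ, ∃ β : ℝ, β₀ ≤ β ∧ ¬ (∃ m : ℝ, 0 < m ∧ ∃ S₁ : ℕ, ∀ A B : YMSpecies Circle,
    ∃ C : ℝ, ∀ S n : ℕ, S₁ ≤ S → n ≤ S →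
    |latticeConnectedCorr u1Rep β (2 * S + 1) A.F B.F n| ≤ C * Real.exp (-(m * n)))

/-! ## §1 The group-blind chain: cold exit ⇒ cold-pressure onset ⇒ torus clustering (EVERY compact `G`) -/

section Chain

variable {G : Type} [Group G] [TopologicalSpace G] [IsTopologicalGroup G] [CompactSpace G]
  [MeasurableSpace G] [BorelSpace G]

/-- `R` per `(G, r, β ≥ 0)`, for EVERY compact `G`: `δᶜ_β(L') ≤ squaringConst · δᶜ_β(L)²` on `8 ≤ L`, `2L ≤ L' ≤ 4L`
(`defectSquaring` on the Wilson family; no simplicity). -/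
theorem coldRecursion (r : LatticeRep G) {β : ℝ} (hβ : 0 ≤ β) (L : ℕ) (hL : 8 ≤ L) (L' : ℕ)
    (h₁ : 2 * L ≤ L') (h₂ : L' ≤ 4 * L) :
    coldDefect r.ρ β L' ≤ squaringConst * coldDefect r.ρ β L ^ 2 := by
  rw [coldDefect_eq_boxDefect, coldDefect_eq_boxDefect]
  exact defectSquaring _ (axisSymmetric r β) (tracePositive r hβ) (volumeBounds r hβ) L hL L' h₁ h₂

/-- **Cold exit ⇒ per-β cold-pressure onset, for EVERY compact `G`** (the bridge seam `coldPressureAt_of_exit_recursion`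
fed with the group-blind recursion at `C = squaringConst`, `L₀ = 8`, at the exit tolerance `1/(16·max C 2)`). -/
theorem coldPressureOnsetAt_of_coldExitAt (r : LatticeRep G) (hE : ColdExitAt r) :
    ∃ β₂ : ℝ, ∀ β : ℝ, β₂ ≤ β → ∃ ξ : ℕ, 1 ≤ ξ ∧ ColdPressureAt r.ρ β ξ := by
  have hC' : 0 < max squaringConst 2 := lt_of_lt_of_le squaringConst_pos (le_max_left _ _)
  obtain ⟨β₁, hβ₁⟩ := hE (1 / (16 * max squaringConst 2)) (by positivity)
  refine ⟨max β₁ 0, fun β hβ => ?_⟩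
  have hββ₁ : β₁ ≤ β := le_trans (le_max_left _ _) hβ
  have hβ0 : 0 ≤ β := le_trans (le_max_right _ _) hβ
  obtain ⟨Ls, hLs, hex⟩ := hβ₁ β hββ₁ 8
  refine ⟨Ls, by omega, ?_⟩
  exact coldPressureAt_of_exit_recursion r hβ0 squaringConst_pos (L₀ := 8)
    (fun L hL L' h₁ h₂ => coldRecursion r hβ0 L hL L' h₁ h₂) (by simpa using hLs) hex

/-- **Per-β cold pressure ⇒ per-β torus clustering, for EVERY compact `G`** (bookkeeping over the landed
`abs_latticeConnectedCorr_le_of_coldPressure` at rate `μ = 1/ξ ≤ 1`, `K = 1`, the volume floor from `volumeFloor_eventually`). -/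
theorem torusClusteringAt_of_coldPressureAt (r : LatticeRep G) {β : ℝ} (hβ0 : 0 ≤ β) {ξ : ℕ} (hξ : 1 ≤ ξ)
    (hcp : ColdPressureAt r.ρ β ξ) : TorusClusteringAt r.ρ β := by
  obtain ⟨C₀, S₁, hC₀, hP⟩ := hcp
  have hξpos : (0 : ℝ) < (ξ : ℝ) := by exact_mod_cast hξ
  set μ : ℝ := 1 / (ξ : ℝ) with hμdef
  have hμ0 : 0 < μ := by rw [hμdef]; positivity
  have hμ1 : μ ≤ 1 := by
    rw [hμdef, div_le_one hξpos]
    exact_mod_cast hξ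
  obtain ⟨S₀, hS₀⟩ := Filter.eventually_atTop.1 (volumeFloor_eventually C₀ μ hC₀ hμ0)
  refine ⟨μ, hμ0, max S₁ S₀, fun A B => ?_⟩
  obtain ⟨CA, hCA⟩ := A.bounded
  obtain ⟨CB, hCB⟩ := B.bounded
  obtain ⟨w, hw⟩ := abs_latticeConnectedCorr_le_of_coldPressure r A B hCA hCB
  refine ⟨max (CA * CB * Real.exp (2 * w) * (2 + 4 * 1 + 1 ^ 2)) (2 * (CA * CB) * Real.exp (2 * w)),
    fun S n hS hn => ?_⟩
  have hK : ∀ S : ℕ, max S₁ S₀ ≤ S → C₀ * ((2 * S + 1 : ℕ) : ℝ) ^ 3 * Real.exp (-(μ * S / 2)) ≤ 1 :=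
    fun S hS => hS₀ S (le_trans (le_max_right _ _) hS)
  have hP' : ∀ S : ℕ, max S₁ S₀ ≤ S → ∀ m : ℕ, S + 1 ≤ 2 * (m + 2) →
      traceExcess r.ρ β (2 * S + 1) (m + 2) ≤
        C₀ * ((2 * S + 1 : ℕ) : ℝ) ^ 3 * Real.exp (-(μ * ((m + 2 : ℕ) : ℝ))) :=
    fun S hS m hm => hP S (le_trans (le_max_left _ _) hS) m hm
  exact hw β hβ0 μ C₀ 1 hμ0.le hμ1 hC₀ _ hK hP' S n hS hn

/-- **Cold exit ⇒ per-β torus clustering beyond a threshold, for EVERY compact `G`.** -/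
theorem torusClustering_of_coldExitAt (r : LatticeRep G) (hE : ColdExitAt r) :
    ∃ β₀ : ℝ, ∀ β : ℝ, β₀ ≤ β → TorusClusteringAt r.ρ β := by
  obtain ⟨β₂, hon⟩ := coldPressureOnsetAt_of_coldExitAt r hE
  refine ⟨max β₂ 0, fun β hβ => ?_⟩
  obtain ⟨ξ, hξ, hcp⟩ := hon β (le_trans (le_max_left _ _) hβ)
  exact torusClusteringAt_of_coldPressureAt r (le_trans (le_max_right _ _) hβ) hξ hcp

end Chain

/-! ## §2 The exposures (kernel): light modes kill cold exit; the binders of `E` are load-bearing -/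

/-- **Light mode kills cold exit — EVERY compact `G`, no simplicity, no π₁.**  `LightFluxMode G → ∀ r, ¬ ColdExitAt r`
(cold exit ⇒ cold-pressure onset ⇒ the landed `coldPressureOnsetAt_false_of_lightFluxMode`). -/
theorem coldExitAt_false_of_lightFluxMode
    (G : Type) [Group G] [TopologicalSpace G] [IsTopologicalGroup G] [CompactSpace G] (hLF : LightFluxMode G) :
    letI : MeasurableSpace G := borel G
    haveI : BorelSpace G := ⟨rfl⟩
    ∀ r : LatticeRep G, ¬ ColdExitAt r := by
  letI : MeasurableSpace G := borel G
  haveI : BorelSpace G := ⟨rfl⟩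
  intro r hE
  exact coldPressureOnsetAt_false_of_lightFluxMode G hLF r (coldPressureOnsetAt_of_coldExitAt r hE)

/-- **The typed necessary condition: `E → NoLightFluxModeSC`.**  Any proof of the seed `E` refutes every light RP-slab mode on
the simply-connected simple class — the weakest consequence of `E` in covariance currency (a KILLABLE necessary condition: a
light mode for `SU(2)` at weak coupling would retire lines 10 ∕ 13 at once). -/
theorem coldExitSC_imp_noLightFluxModeSC (hE : ColdExitSC) : NoLightFluxModeSC := by
  intro G _ _ _ _ hG hsc hLF
  obtain ⟨r⟩ := hG.2
  exact coldExitAt_false_of_lightFluxMode G hLF r (hE G hG hsc r)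

/-- The binder-deleted forms are STRENGTHENINGS of `E` (deleting hypotheses): `ColdExitAllGroups → ColdExitSimple → E`. -/
theorem coldExitSimple_of_allGroups (h : ColdExitAllGroups) : ColdExitSimple :=
  fun G _ _ _ _ _ => h G

theorem coldExitSC_of_simple (h : ColdExitSimple) : ColdExitSC :=
  fun G _ _ _ _ hG _ => h G hG

/-- **The π₁-binder of `E` is load-bearing**: `E` with `SimplyConnectedSpace G` deleted is FALSE modulo `LightFluxMode SO(3)`
('t Hooft's light ℤ₂ magnetic flux of the confined phase; `SO(3)` is admissible: `isCompactSimpleLieGroup_SO3`). -/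
theorem not_coldExitSimple_of_lightFluxMode_SO3
    (hH : @LightFluxMode SO3 _ _ so3_isTopologicalGroup so3_compactSpace) : ¬ ColdExitSimple := by
  intro h
  have hneg := @coldExitAt_false_of_lightFluxMode SO3 _ _ so3_isTopologicalGroup so3_compactSpace hH
  have hpos := @h SO3 _ _ so3_isTopologicalGroup so3_compactSpace isCompactSimpleLieGroup_SO3
  obtain ⟨r⟩ := nonempty_latticeRep_SO3
  exact hneg r (hpos r)

/-- **Both group binders of `E` fail at `U(1)` and the binder-free `E` is FALSE there, RP-slab currency**:
`LightFluxMode Circle → ¬ ColdExitAllGroups` (the photon as a light RP-slab mode). -/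
theorem not_coldExitAllGroups_of_lightFluxMode_circle (hH : LightFluxMode Circle) : ¬ ColdExitAllGroups := by
  intro h
  have hneg := coldExitAt_false_of_lightFluxMode Circle hH
  exact hneg LatticeRep.circle (h Circle LatticeRep.circle)

/-- **Cold exit at `U(1)` (charge-one Wilson action, `LatticeRep.circle = ⟨1, u1Rep, …⟩`) forces per-β torus clustering at
every large `β`** — the group-blind chain read at `G = Circle`. -/
theorem torusClustering_of_coldExitAt_circle (hE : ColdExitAt LatticeRep.circle) :
    ∃ β₀ : ℝ, ∀ β : ℝ, β₀ ≤ β → TorusClusteringAt LatticeRep.circle.ρ β :=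
  torusClustering_of_coldExitAt LatticeRep.circle hE

/-- **The binder-free `E` is FALSE at `U(1)`, species currency**: `U1TorusMassless → ¬ ColdExitAllGroups` — SAME hypothesis as the
landed `NonSimplyConnectedLatticeGap` negative, so one torus-photon theorem discharges both.  `U(1)` passes every clause of the two
binders except `∃ a b, a * b ≠ b * a` and `π₁ = 1` (`circle_passes_all_but_nonAbelian`). -/
theorem not_coldExitAllGroups_of_u1TorusMassless (hU : U1TorusMassless) : ¬ ColdExitAllGroups := by
  intro h
  have hE : ColdExitAt LatticeRep.circle := h Circle LatticeRep.circle
  obtain ⟨β₀, hβ₀⟩ := torusClustering_of_coldExitAt LatticeRep.circle hE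
  obtain ⟨β, hb, hno⟩ := hU β₀
  exact hno (hβ₀ β hb)

/-- **What `U(1)` passes** (recorded for the audit: the witness fails EXACTLY the non-abelian clause of `IsCompactSimpleLieGroup`
and the binder `SimplyConnectedSpace`). -/
theorem circle_fails_only_nonAbelian_and_pi1 :
    ConnectedSpace Circle ∧
      (∀ N : Subgroup Circle, N.Normal → IsClosed (N : Set Circle) →
        IsPreconnected (N : Set Circle) → N = ⊥ ∨ N = ⊤) ∧
      Nonempty (LatticeRep Circle) ∧ ¬ SimplyConnectedSpace Circle ∧ ¬ (∃ a b : Circle, a * b ≠ b * a) :=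
  circle_passes_all_but_nonAbelian

/-! ## §3 The line's registered stubs and compositions

The POSITIVE obligations are those of line 10 (`doubling-bridge`, `Lines/doubling_bridge.lean` rev 2) BY NAME — E, X, N, with
R discharged by the tree's `coldDoublingRecursionSC_holds`; they are re-declared here only so that this workfile concludes the
leaf and the exposures of §2 are read against THIS `E`.  The one stub proper to this line is `stub_u1TorusMassless`. -/

/-- stub E (line 10's, shared — NOT new): one ε-pure 4:1 cold torus per weak coupling, simply-connected simple `G`.
§2 shows any proof must use `SimplyConnectedSpace G` (SO(3)) and cannot be group-blind (U(1)). -/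
theorem stub_coldExitSC : ColdExitSC := by
  sorry

/-- stub X (line 10's / the pincer's, shared — NOT new): asymptotic freedom ⇒ cold pressure at the UV end. -/
theorem stub_afToColdPressure : AFToColdPressure := by
  sorry

/-- stub N (residual, shared — NOT new): the non-simply-connected half of `IR` by name. -/
theorem stub_irnsc : IRnsc := by
  sorry

/-- **stub proper to this line (L–XL, classical constructive QFT, OPEN as typed): the Guth–Fröhlich–Spencer photon of Wilson
`U(1)₄` on tori, species form.**  NOT on the path to `IR`; it makes `exposure` below unconditional AND discharges the hypothesis of
the landed `NonSimplyConnectedLatticeGap` negative. [cite: FrohlichSpencerCMP1982, §2.11] [cite: Guth1980] -/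
theorem stub_u1TorusMassless : U1TorusMassless := by
  sorry

/-- **Exposure, composed over the stub**: no group-blind proof of the seed `E` exists (the binder-free `E` is false). -/
theorem exposure : ¬ ColdExitAllGroups :=
  not_coldExitAllGroups_of_u1TorusMassless stub_u1TorusMassless

/-- **The positive composition BY NAME (line 10 `doubling-bridge`, nothing new): `E ∧ X ∧ N ⇒ IR` with
`R := coldDoublingRecursionSC_holds`.** -/
theorem IR_of_stubs : Summit.QuantumFields.YangMills.Theses.BalabanLadder.IR :=
  IR_of_bridge coldDoublingRecursionSC_holds stub_coldExitSC stub_afToColdPressure stub_irnsc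

/-- What the stubs of THIS file jointly certify: the leaf, and that its seed is not group-blind. -/
theorem IR_and_exposure : Summit.QuantumFields.YangMills.Theses.BalabanLadder.IR ∧ ¬ ColdExitAllGroups :=
  ⟨IR_of_stubs, exposure⟩

end Summit.QuantumFields.YangMills.Cruxes.IR.LightModeExposure

end
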